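import Mathlib
import Summits.ResolutionOfSingularities.ResolutionOfSingularities.Theorems.WeightedInvariantLocalWeightedDropPolyDescentDefs
import Summits.ResolutionOfSingularities.ResolutionOfSingularities.Theorems.WeightedInvariantLocalWeightedDropWildMonicShiftCoeff

/-!
# `WeightedInvariant.LocalWeightedDrop`, stub S3ρ, line «monic polyhedron descent», piece (ρ-B) part (B-ii): THE AXIS-VERTEX LEMMA —
# a re-centring with a pure `u_l`-part creates a SOLVABLE vertex on the `u_l`-axis

Crux item stmt-ResolutionOfSingularities-8899 `LocalWeightedDrop` (route `ResolutionOfSingularities/WeightedInvariant`), engine skeleton v30, stub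
S3ρ `stub_wildMonicSurfaceReductionWon`; line file `L/res-L1-w43-lead-1/g3/poly_descent_line_v1.lean`, sub-stub (ρ-B) `PolyDescent.stub_polyBridge`.
[OURS · L1 W4.3, chain w43; res-D-pv-058 (acting as res-L1-w43-stub-6) for res-L1-w43-lead-1's line; the tool behind the two EXITS of the game
bridge that the pure key got for free from cleaning: (a) a well-prepared label of order `d` is never «wide» (no linear re-centring restores a
position), (b) ROW TRANSFER (general-degree `MonicDescent.isPermissibleTwo_of_wellPrepared_of_recentre`).  MODEL: Hironaka's vertex preparation
(CJS LNM 2270 Ch. 8): the `y ↦ y + c u^v + …` re-centring of a form with no competing pure `u_l`-monomials puts the solvable vertex `d!·m·e_l` on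
the polyhedron.  Nothing here is a statement of any manuscript; no definitions.]

For `P : Fin d → k⟦u₁,u₂⟧`, a letter `l`, `m ≥ 1` and `ψ` whose pure `u_l`-part has order exactly `m` with leading coefficient `c ≠ 0`, assume every
pure `u_l`-monomial `u_l^n` of `P_i` has `n > m(d − i)` (e.g. `P` a position and `m = 1`; or `u_{l'} ∣ P_i` for all `i`).  Let `T = shift d P ψ`
(the re-centring `y ↦ y + ψ`).  Then, slot by slot, the pure `u_l`-part of `T_j` is `C(d,j) c^{d−j} u_l^{m(d−j)} + (higher)`
(`coeff_axis_shift_of_lt`, `coeff_axis_shift_self`); hence the scaled point `Q = (d!·m)·e_l` lies on `newtonSet T` (`axisPoint_mem_newtonSet_shift`),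
is a VERTEX (`isVertex_axisPoint_shift`), has vertex coefficients `C(d,j) c^{d−j}` (`vertexCoeff_axisPoint_shift`), so is SOLVABLE
(`solvable_axisPoint_shift`) and `T` is NOT well-prepared (`not_wellPrepared_shift_of_axis`).
-/

set_option linter.dupNamespace false -- mandated namespace of this single-conjunct summit

namespace Summit.ResolutionOfSingularities.ResolutionOfSingularities.Theorems

namespace PolyDescent

open MvPowerSeries MonicDescent WildMonic

variable {k : Type} [Field k]

/-! ## Restriction to the `u_l`-axis (a substitution, hence multiplicative) -/

/-- The axis substitution `u_l ↦ X`, `u_{l'} ↦ 0` is admissible. -/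
private theorem hasSubst_axis (l : Fin 2) : HasSubst (fun i : Fin 2 => if i = l then (PowerSeries.X : PowerSeries k) else 0) :=
  hasSubst_of_constantCoeff_zero fun i => by
    split_ifs
    · exact PowerSeries.constantCoeff_X
    · exact map_zero _

/-- The coefficients of `H(u_l ↦ X, u_{l'} ↦ 0)` are the pure `u_l`-coefficients of `H`. -/
private theorem coeff_subst_axis (l : Fin 2) (H : MvPowerSeries (Fin 2) k) (a : ℕ) :
    PowerSeries.coeff a (subst (fun i : Fin 2 => if i = l then (PowerSeries.X : PowerSeries k) else 0) H) =
      coeff (Finsupp.single l a) H := by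
  classical
  have hprod : ∀ e : Fin 2 →₀ ℕ, (e.prod fun s n => (if s = l then (PowerSeries.X : PowerSeries k) else 0) ^ n) =
      if e = Finsupp.single l (e l) then PowerSeries.X ^ (e l) else 0 := by
    intro e
    rw [Finsupp.prod_fintype _ _ (fun i => pow_zero _)]
    by_cases he : e = Finsupp.single l (e l)
    · rw [if_pos he]
      have h2 : ∀ s, s ≠ l → e s = 0 := fun s hs => by rw [he, Finsupp.single_apply, if_neg (Ne.symm hs)]
      rw [← Finset.prod_erase_mul _ _ (Finset.mem_univ l), if_pos rfl, Finset.prod_eq_one (fun s hs => ?_), one_mul]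
      rw [h2 s (Finset.ne_of_mem_erase hs), pow_zero]
    · rw [if_neg he]
      obtain ⟨s, hs, hes⟩ : ∃ s, s ≠ l ∧ e s ≠ 0 := by
        by_contra hcon
        push Not at hcon
        apply he
        ext i
        by_cases hil : i = l
        · subst hil; rw [Finsupp.single_eq_same]
        · rw [Finsupp.single_apply, if_neg (Ne.symm hil)]; exact hcon i hil
      exact Finset.prod_eq_zero (Finset.mem_univ s) (by rw [if_neg hs, zero_pow hes])
  show MvPowerSeries.coeff (Finsupp.single () a) _ = _
  rw [coeff_subst (hasSubst_axis l) H, finsum_eq_single _ (Finsupp.single l a)]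
  · rw [hprod, Finsupp.single_eq_same, if_pos rfl,
      show MvPowerSeries.coeff (Finsupp.single () a) ((PowerSeries.X : PowerSeries k) ^ a) =
        PowerSeries.coeff a ((PowerSeries.X : PowerSeries k) ^ a) from rfl, PowerSeries.coeff_X_pow_self, smul_eq_mul, mul_one]
  · intro e he
    rw [hprod]
    split_ifs with h
    · have hne : e l ≠ a := fun hla => he (by rw [h, hla])
      rw [show MvPowerSeries.coeff (Finsupp.single () a) ((PowerSeries.X : PowerSeries k) ^ (e l)) =
        PowerSeries.coeff a ((PowerSeries.X : PowerSeries k) ^ (e l)) from rfl, PowerSeries.coeff_X_pow, if_neg (Ne.symm hne), smul_zero]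
    · rw [map_zero, smul_zero]

/-- Divisibility of the axis restriction by `X^n` from the vanishing of the low pure `u_l`-coefficients. -/
private theorem X_pow_dvd_subst_axis (l : Fin 2) (H : MvPowerSeries (Fin 2) k) (n : ℕ)
    (h : ∀ a < n, coeff (Finsupp.single l a) H = 0) :
    (PowerSeries.X : PowerSeries k) ^ n ∣ subst (fun i : Fin 2 => if i = l then (PowerSeries.X : PowerSeries k) else 0) H := by
  rw [PowerSeries.X_pow_dvd_iff]
  intro a ha
  rw [coeff_subst_axis]
  exact h a ha

/-! ## The pure `u_l`-part of the re-centred tuple -/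

/-- **The pure `u_l`-part of `(shift d P ψ)_j` starts at `u_l^{m(d−j)}` with coefficient `C(d,j)·c^{d−j}`**, `c = [u_l^m]ψ`, when the pure
`u_l`-part of `ψ` has order `≥ m` and every pure monomial `u_l^n` of `P_i` has `n > m(d − i)`. -/
theorem coeff_axis_shift (l : Fin 2) {d : ℕ} (P : Fin d → MvPowerSeries (Fin 2) k) (ψ : MvPowerSeries (Fin 2) k) (m : ℕ)
    (hψ : ∀ n < m, coeff (Finsupp.single l n) ψ = 0)
    (hP : ∀ (i : Fin d) (n : ℕ), n ≤ m * (d - (i : ℕ)) → coeff (Finsupp.single l n) (P i) = 0) (j : Fin d) :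
    (∀ a < m * (d - (j : ℕ)), coeff (Finsupp.single l a) (shift d P ψ j) = 0) ∧
      coeff (Finsupp.single l (m * (d - (j : ℕ)))) (shift d P ψ j) =
        (((d.choose (j : ℕ) : ℕ) : k)) * (coeff (Finsupp.single l m) ψ) ^ (d - (j : ℕ)) := by
  classical
  -- the axis restriction `π` (an algebra map)
  set a₀ : Fin 2 → PowerSeries k := fun i : Fin 2 => if i = l then (PowerSeries.X : PowerSeries k) else 0 with ha₀
  have hA : HasSubst a₀ := hasSubst_axis l
  set π : MvPowerSeries (Fin 2) k →ₐ[k] PowerSeries k := substAlgHom hA with hπ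
  have hπc : ∀ (H : MvPowerSeries (Fin 2) k) (a : ℕ), PowerSeries.coeff a (π H) = coeff (Finsupp.single l a) H := fun H a => by
    rw [hπ, substAlgHom_apply]; exact coeff_subst_axis l H a
  have hπdvd : ∀ (H : MvPowerSeries (Fin 2) k) (n : ℕ), (∀ a < n, coeff (Finsupp.single l a) H = 0) →
      (PowerSeries.X : PowerSeries k) ^ n ∣ π H := fun H n h => by
    rw [hπ, substAlgHom_apply]; exact X_pow_dvd_subst_axis l H n h
  -- `π ψ = X^m · v`
  obtain ⟨v, hv⟩ := hπdvd ψ m hψ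
  have hvc : PowerSeries.constantCoeff v = coeff (Finsupp.single l m) ψ := by
    rw [← hπc, hv, ← PowerSeries.coeff_zero_eq_constantCoeff_apply, ← PowerSeries.coeff_X_pow_mul v m 0, zero_add]
  -- the image of the Taylor sum
  set N := d - (j : ℕ) with hN
  have hTj : π (shift d P ψ j) = (∑ n ∈ Finset.range N, π ((((n + (j : ℕ)).choose (j : ℕ) : ℕ) : MvPowerSeries (Fin 2) k)) *
      π ((monicPoly d P).coeff (n + (j : ℕ))) * π ψ ^ n) + (((d.choose (j : ℕ) : ℕ) : PowerSeries k)) * π ψ ^ N := by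
    rw [shift_eq_sum, map_sum, Finset.sum_range_succ, map_mul, map_mul, map_pow, show N + (j : ℕ) = d by omega,
      coeff_monicPoly_self, map_one, mul_one, map_natCast]
    congr 1
    refine Finset.sum_congr rfl fun n _ => ?_
    rw [map_mul, map_mul, map_pow]
  -- the lower terms are divisible by `X^{mN+1}`
  have hlow : (PowerSeries.X : PowerSeries k) ^ (m * N + 1) ∣ ∑ n ∈ Finset.range N,
      π ((((n + (j : ℕ)).choose (j : ℕ) : ℕ) : MvPowerSeries (Fin 2) k)) * π ((monicPoly d P).coeff (n + (j : ℕ))) * π ψ ^ n := by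
    refine Finset.dvd_sum fun n hn => ?_
    rw [Finset.mem_range] at hn
    have hlt : n + (j : ℕ) < d := by omega
    have h1 : (PowerSeries.X : PowerSeries k) ^ (m * (d - (n + (j : ℕ))) + 1) ∣ π ((monicPoly d P).coeff (n + (j : ℕ))) := by
      rw [show (monicPoly d P).coeff (n + (j : ℕ)) = P ⟨n + (j : ℕ), hlt⟩ from coeff_monicPoly_of_lt d P ⟨n + (j : ℕ), hlt⟩]
      exact hπdvd _ _ fun a ha => hP ⟨n + (j : ℕ), hlt⟩ a (by simp only; omega)
    have h2 : (PowerSeries.X : PowerSeries k) ^ (m * n) ∣ π ψ ^ n := by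
      rw [pow_mul]; exact pow_dvd_pow_of_dvd ⟨v, hv⟩ n
    have h3 := mul_dvd_mul h1 h2
    rw [← pow_add, show m * (d - (n + (j : ℕ))) + 1 + m * n = m * N + 1 by
      rw [hN, show d - (j : ℕ) = (d - (n + (j : ℕ))) + n by omega, mul_add]; ring] at h3
    rw [mul_assoc]
    exact Dvd.dvd.mul_left h3 _
  obtain ⟨S, hS⟩ := hlow
  -- the closed form of `π (T j)`
  have hclosed : π (shift d P ψ j) = PowerSeries.X ^ (m * N) *
      (PowerSeries.X * S + (((d.choose (j : ℕ) : ℕ) : PowerSeries k)) * v ^ N) := by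
    rw [hTj, hS, hv, mul_pow, ← pow_mul]
    ring
  constructor
  · intro a ha
    rw [← hπc, hclosed, PowerSeries.coeff_X_pow_mul', if_neg (by omega)]
  · rw [← hπc, hclosed, PowerSeries.coeff_X_pow_mul', if_pos le_rfl, Nat.sub_self, map_add,
      PowerSeries.coeff_zero_eq_constantCoeff_apply, map_mul, PowerSeries.constantCoeff_X, zero_mul, zero_add,
      PowerSeries.coeff_zero_eq_constantCoeff_apply, map_mul, map_pow, map_natCast, hvc]

/-- Contrapositive of the vanishing part of `coeff_axis_shift`: a pure `u_l`-exponent `a` of `(shift d P ψ)_j` has `a ≥ m(d−j)`. -/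
theorem le_of_coeff_axis_shift_ne_zero (l : Fin 2) {d : ℕ} (P : Fin d → MvPowerSeries (Fin 2) k) (ψ : MvPowerSeries (Fin 2) k) (m : ℕ)
    (hψ : ∀ n < m, coeff (Finsupp.single l n) ψ = 0)
    (hP : ∀ (i : Fin d) (n : ℕ), n ≤ m * (d - (i : ℕ)) → coeff (Finsupp.single l n) (P i) = 0) (j : Fin d) {a : ℕ}
    (ha : coeff (Finsupp.single l a) (shift d P ψ j) ≠ 0) : m * (d - (j : ℕ)) ≤ a := by
  by_contra hlt
  exact ha ((coeff_axis_shift l P ψ m hψ hP j).1 a (by omega))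

/-- The axis point `(d!·m)·e_l` is `w_j · (m(d−j))·e_l` for every slot `j`. -/
theorem axisPoint_eq_smul (l : Fin 2) {d : ℕ} (j : Fin d) (m : ℕ) :
    (Finsupp.single l (d.factorial * m) : Fin 2 →₀ ℕ) = slotWeight d j • Finsupp.single l (m * (d - (j : ℕ))) := by
  rw [Finsupp.smul_single, smul_eq_mul, ← slotWeight_mul_sub j]
  congr 1
  ring

/-- **The axis point `(d!·m)·e_l` is a Newton point of the re-centred tuple** (slot `0`: `[u_l^{md}](shift d P ψ)_0 = c^d ≠ 0`). -/
theorem axisPoint_mem_newtonSet_shift (l : Fin 2) {d : ℕ} (hd : 0 < d) (P : Fin d → MvPowerSeries (Fin 2) k)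
    (ψ : MvPowerSeries (Fin 2) k) (m : ℕ) (hψ : ∀ n < m, coeff (Finsupp.single l n) ψ = 0) (hc : coeff (Finsupp.single l m) ψ ≠ 0)
    (hP : ∀ (i : Fin d) (n : ℕ), n ≤ m * (d - (i : ℕ)) → coeff (Finsupp.single l n) (P i) = 0) :
    Finsupp.single l (d.factorial * m) ∈ newtonSet (shift d P ψ) := by
  refine ⟨⟨0, hd⟩, Finsupp.single l (m * (d - 0)), ?_, axisPoint_eq_smul l ⟨0, hd⟩ m⟩
  rw [(coeff_axis_shift l P ψ m hψ hP ⟨0, hd⟩).2, Nat.choose_zero_right, Nat.cast_one, one_mul]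
  exact pow_ne_zero _ hc

/-- **Every Newton point of the re-centred tuple on the `u_l`-axis lies at or beyond `(d!·m)·e_l`.** -/
theorem le_of_mem_newtonSet_shift_axis (l : Fin 2) {d : ℕ} (P : Fin d → MvPowerSeries (Fin 2) k) (ψ : MvPowerSeries (Fin 2) k) (m : ℕ)
    (hψ : ∀ n < m, coeff (Finsupp.single l n) ψ = 0)
    (hP : ∀ (i : Fin d) (n : ℕ), n ≤ m * (d - (i : ℕ)) → coeff (Finsupp.single l n) (P i) = 0)
    {R : Fin 2 →₀ ℕ} (hR : R ∈ newtonSet (shift d P ψ)) (hRl : ∀ i, i ≠ l → R i = 0) : d.factorial * m ≤ R l := by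
  obtain ⟨j, e, he, rfl⟩ := hR
  have he' : e = Finsupp.single l (e l) := by
    ext i
    by_cases hil : i = l
    · subst hil; rw [Finsupp.single_eq_same]
    · rw [Finsupp.single_apply, if_neg (Ne.symm hil)]
      have := hRl i hil
      rw [Finsupp.smul_apply, smul_eq_mul] at this
      rcases mul_eq_zero.mp this with h0 | h0
      · exact absurd h0 (slotWeight_pos j).ne'
      · exact h0
  rw [he'] at he
  have hle := le_of_coeff_axis_shift_ne_zero l P ψ m hψ hP j he
  rw [Finsupp.smul_apply, smul_eq_mul, ← slotWeight_mul_sub j]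
  calc slotWeight d j * (d - (j : ℕ)) * m = slotWeight d j * (m * (d - (j : ℕ))) := by ring
    _ ≤ slotWeight d j * e l := Nat.mul_le_mul_left _ hle

/-- **The axis point is a VERTEX of the Newton set of the re-centred tuple** (exposed by the weight `1` on `u_l`, `d!·m + 1` on the other letter). -/
theorem isVertex_axisPoint_shift (l : Fin 2) {d : ℕ} (hd : 0 < d) (P : Fin d → MvPowerSeries (Fin 2) k)
    (ψ : MvPowerSeries (Fin 2) k) (m : ℕ) (hψ : ∀ n < m, coeff (Finsupp.single l n) ψ = 0) (hc : coeff (Finsupp.single l m) ψ ≠ 0)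
    (hP : ∀ (i : Fin d) (n : ℕ), n ≤ m * (d - (i : ℕ)) → coeff (Finsupp.single l n) (P i) = 0) :
    IsVertex (newtonSet (shift d P ψ)) (Finsupp.single l (d.factorial * m)) := by
  classical
  set M := d.factorial * m with hM
  refine ⟨axisPoint_mem_newtonSet_shift l hd P ψ m hψ hc hP, fun i => if i = l then 1 else M + 1,
    fun i => by dsimp only; split_ifs <;> omega, fun R hR hne => ?_⟩
  have hw : ∀ F : Fin 2 →₀ ℕ, Finsupp.weight (fun i : Fin 2 => if i = l then 1 else M + 1) F =
      ∑ i : Fin 2, F i * (if i = l then 1 else M + 1) := fun F => by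
    rw [Finsupp.weight_apply, Finsupp.sum_fintype _ _ (by simp)]
    rfl
  rw [hw, hw]
  -- the value at the axis point is `M`
  have hQ : ∑ i : Fin 2, (Finsupp.single l M : Fin 2 →₀ ℕ) i * (if i = l then 1 else M + 1) = M := by
    rw [Finset.sum_eq_single l]
    · rw [Finsupp.single_eq_same, if_pos rfl, mul_one]
    · intro i _ hil; rw [Finsupp.single_apply, if_neg (Ne.symm hil), zero_mul]
    · intro h; exact absurd (Finset.mem_univ l) h
  rw [hQ]
  by_cases hoff : ∀ i, i ≠ l → R i = 0
  · -- `R` on the axis: `R l > M`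
    have hle := le_of_mem_newtonSet_shift_axis l P ψ m hψ hP hR hoff
    have hRl : R l ≠ M := by
      intro h
      apply hne
      ext i
      by_cases hil : i = l
      · subst hil; rw [Finsupp.single_eq_same, h]
      · rw [Finsupp.single_apply, if_neg (Ne.symm hil)]; exact hoff i hil
    calc M < R l := by omega
      _ = R l * (if l = l then 1 else M + 1) := by rw [if_pos rfl, mul_one]
      _ ≤ ∑ i : Fin 2, R i * (if i = l then 1 else M + 1) :=
          Finset.single_le_sum (f := fun i => R i * (if i = l then 1 else M + 1)) (fun i _ => Nat.zero_le _) (Finset.mem_univ l)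
  · -- `R` off the axis: the other letter alone contributes `≥ M + 1`
    push Not at hoff
    obtain ⟨i, hil, hRi⟩ := hoff
    calc M < R i * (if i = l then 1 else M + 1) := by
          rw [if_neg hil]; have : 1 ≤ R i := Nat.pos_of_ne_zero hRi; nlinarith
      _ ≤ ∑ i : Fin 2, R i * (if i = l then 1 else M + 1) :=
          Finset.single_le_sum (f := fun i => R i * (if i = l then 1 else M + 1)) (fun i _ => Nat.zero_le _) (Finset.mem_univ i)

/-- **The vertex coefficients at the axis point are the binomial ones**: `vertexCoeff_j = C(d,j)·c^{d−j}`, `c = [u_l^m]ψ`. -/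
theorem vertexCoeff_axisPoint_shift (l : Fin 2) {d : ℕ} (P : Fin d → MvPowerSeries (Fin 2) k) (ψ : MvPowerSeries (Fin 2) k) (m : ℕ)
    (hψ : ∀ n < m, coeff (Finsupp.single l n) ψ = 0)
    (hP : ∀ (i : Fin d) (n : ℕ), n ≤ m * (d - (i : ℕ)) → coeff (Finsupp.single l n) (P i) = 0) (j : Fin d) :
    vertexCoeff d (shift d P ψ) (Finsupp.single l (d.factorial * m)) j =
      (((d.choose (j : ℕ) : ℕ) : k)) * (coeff (Finsupp.single l m) ψ) ^ (d - (j : ℕ)) := by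
  rw [axisPoint_eq_smul l j m, vertexCoeff_smul, (coeff_axis_shift l P ψ m hψ hP j).2]

/-- **The axis point is SOLVABLE** (integral, vertex polynomial `(Y + c)^d`). -/
theorem solvable_axisPoint_shift (l : Fin 2) {d : ℕ} (P : Fin d → MvPowerSeries (Fin 2) k) (ψ : MvPowerSeries (Fin 2) k) (m : ℕ)
    (hψ : ∀ n < m, coeff (Finsupp.single l n) ψ = 0)
    (hP : ∀ (i : Fin d) (n : ℕ), n ≤ m * (d - (i : ℕ)) → coeff (Finsupp.single l n) (P i) = 0) :
    Solvable d (shift d P ψ) (Finsupp.single l (d.factorial * m)) := by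
  refine ⟨fun i => ?_, coeff (Finsupp.single l m) ψ, fun j => vertexCoeff_axisPoint_shift l P ψ m hψ hP j⟩
  rw [Finsupp.single_apply]
  split_ifs
  · exact Dvd.intro m rfl
  · exact dvd_zero _

/-- **THE AXIS-VERTEX LEMMA**: under the hypotheses of the module docstring (`0 < d`, `[u_l^m]ψ ≠ 0`, no pure `u_l^n` in `ψ` below `n = m`, none
in `P_i` up to `n = m(d−i)`), the re-centred tuple `shift d P ψ` is NOT well-prepared: `(d!·m)·e_l` is a solvable vertex. -/
theorem not_wellPrepared_shift_of_axis (l : Fin 2) {d : ℕ} (hd : 0 < d) (P : Fin d → MvPowerSeries (Fin 2) k)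
    (ψ : MvPowerSeries (Fin 2) k) (m : ℕ) (hψ : ∀ n < m, coeff (Finsupp.single l n) ψ = 0) (hc : coeff (Finsupp.single l m) ψ ≠ 0)
    (hP : ∀ (i : Fin d) (n : ℕ), n ≤ m * (d - (i : ℕ)) → coeff (Finsupp.single l n) (P i) = 0) :
    ¬ WellPrepared d (shift d P ψ) := fun hWP =>
  hWP _ (isVertex_axisPoint_shift l hd P ψ m hψ hc hP) (solvable_axisPoint_shift l P ψ m hψ hP)

end PolyDescent

end Summit.ResolutionOfSingularities.ResolutionOfSingularities.Theorems
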